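import Summits.Ventures.HSemireg.SignedPureWeilAngles

/-!
# Venture HSemireg — TIGHT SLICES: at the ceiling `#supp m = 2·B` of THEOREM B the slice structure of a pure design is RIGID — adjacent
# (axis W) resp. opposite (diagonal W) slices are DISJOINT and every such slice pair is an EXACT minimal support of the other class

HONEST FRAMING. Part of the Lean index of the computation cell `pub-hsemireg` (Sunday typer seat p9, § g = 8; family B row **B20-3** of
`target-g8/CENSUS.md`: signed pure-Weil unit-graph designs are «class witnesses — cycles with ℤ-coefficients — not census objects»).
FINITE GAUSSIAN-INTEGER ARITHMETIC ONLY, in the vocabulary of `SignedPureWeilLadder.lean` ∕ `SignedPureWeilSlicePairs.lean` ∕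
`SignedPureWeilAngles.lean` (`Letter`, `Eps`, `vmoment`, `plus`, `minus`, `supp`, `sl`, `slOpp`, `sliceSupp`, `IsAxis`, `IsDiag`,
`card_supp_sl_le`, `card_supp_slOpp_le`, `supp_sl_subset`, `supp_slOpp_subset`, `sum_card_slices`, `isDiag_vmoment_sl_iff`,
`isDiag_vmoment_slOpp_iff`, `sl_pure`, `sl_alive`, `slOpp_pure`, `slOpp_alive`). No abelian variety, cycle, sheaf or semiregularity map
is constructed; nothing here says that HC ∕ HC_CM ∕ HC_AV holds; no object is certified; no Literature fact is declared; no verdict ∕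
door word ∕ count of the cell moves. The level-4 input «s_diag(4) ≥ 36» of §3 is a MACHINE statement of record (t-8 g15 RESULT #8,
`target-g6/CLASSMODE-ES4-t8g15.md` R8: the diag-mode censuses K = 33, 34, 35 are complete with 0 supports; p9 D33∕D34 runs agree where
complete); here it is an explicit HYPOTHESIS, never an axiom.

THE STATEMENTS (every n ≥ 1; `m` pure and W-alive on (ℤ∕4)ⁿ⁺¹ with slices `m_b = m(b, ·)`, slice supports `A_b = sliceSupp m b`,
adjacent pair designs `sl m a = m_a + m_{a+1}`, opposite pair designs `slOpp m a = m_a − m_{a+2}`). THEOREM B of `SignedPureWeilAngles`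
says `#supp m ≥ 2·B` whenever every pure design on (ℤ∕4)ⁿ with nonzero DIAGONAL Weil moment has ≥ B letters and W(m) is axis (via
the four adjacent pairs, whose moments are diagonal) or diagonal (via the two opposite pairs). THIS FILE is the EQUALITY CASE:
**`tight_adjacent_of_axis`** — if W(m) is AXIS and `#supp m ≤ 2·B`, then `#supp m = 2·B` and for EVERY a: `#supp (sl m a) = B`,
`#A_a + #A_{a+1} = B`, `A_a` and `A_{a+1}` are DISJOINT, `supp (sl m a) = A_a ∪ A_{a+1}` (the pair design fills the two slices
exactly: an exact B-support of the diagonal class), and `#A_a = #A_{a+2}`; **`tight_opposite_of_diag`** — if W(m) is DIAGONAL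
and `#supp m ≤ 2·B`, then `#supp m = 2·B` and for a = 0, 1: `#supp (slOpp m a) = B`, `#A_a + #A_{a+2} = B`, `A_a`, `A_{a+2}`
DISJOINT, `supp (slOpp m a) = A_a ∪ A_{a+2}`. §3 instantiates n = 4, B = 36 under the hypothesis s_diag(4) ≥ 36:
**`k72_adjacent_structure`** ∕ **`k72_opposite_structure`** — a 72-letter pure design on (ℤ∕4)⁵ with axis (resp. diagonal) Weil
moment is glued from four (resp. two) exact DIAGONAL 36-supports on (ℤ∕4)⁴ along pairwise-disjoint adjacent (resp. opposite)
slices. This is the structure theorem behind the seat's K = 72 assembly search (`HOME/p9/K72-ASSEMBLY-p9g12.md`: both cases searched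
exactly over the 17 known diagonal 36-orbits — no 72-design; completeness waits for the full diag-mode K = 36 census) and behind the
observed shape of every record design (design80 ∕ 80alt ∕ 80c ∕ 84 ∕ 96 are tight: pair sizes 40, 40, 38–42, 42, 48).

WHAT IS NOT HERE. s_diag(4) ≥ 36 itself (machine); the census; W «other» (THEOREM B gives 2·s_other there); anything about K > 2B.
-/

namespace Summit.Ventures.HSemireg.SignedWeilDesignN

open Finset

variable {n : ℕ}

/-! ## §1 Two finite-set facts -/

/-- If `S ⊆ A ∪ B` and `#A + #B ≤ #S` then `A` and `B` are disjoint and `S = A ∪ B`. -/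
theorem disjoint_and_eq_union_of_card {α : Type*} [DecidableEq α] (S A B : Finset α) (hsub : S ⊆ A ∪ B)
    (hcard : A.card + B.card ≤ S.card) : Disjoint A B ∧ S = A ∪ B := by
  have hu : (A ∪ B).card ≤ A.card + B.card := Finset.card_union_le A B
  have hS : S.card ≤ (A ∪ B).card := Finset.card_le_card hsub
  have hi := Finset.card_union_add_card_inter A B
  have hinter : (A ∩ B).card = 0 := by omega
  refine ⟨?_, Finset.eq_of_subset_of_card_le hsub (by omega)⟩
  rw [Finset.disjoint_iff_inter_eq_empty]
  exact Finset.card_eq_zero.mp hinter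

/-! ## §2 The equality case of THEOREM B -/

/-- **TIGHT ADJACENT SLICES (W axis).** If every pure design on (ℤ∕4)ⁿ with nonzero diagonal Weil moment has at least `B` letters,
and `m` is a pure design on (ℤ∕4)ⁿ⁺¹ with nonzero AXIS Weil moment and at most `2·B` letters, then `#supp m = 2·B` exactly and every
adjacent slice pair is tight: the pair design has exactly `B` letters, the two slices are disjoint with `#A_a + #A_{a+1} = B`, the pair
design's support is their union, and opposite slices have equal size. -/
theorem tight_adjacent_of_axis (hn : 0 < n) (B : ℕ)
    (h₁ : ∀ d : Letter n → ℤ, (∀ ε' : Eps n, ε' ≠ plus → ε' ≠ minus → vmoment d ε' = 0) →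
      IsDiag (vmoment d plus) → vmoment d plus ≠ 0 → B ≤ (supp d).card)
    (m : Letter (n + 1) → ℤ) (hpure : ∀ ε : Eps (n + 1), ε ≠ plus → ε ≠ minus → vmoment m ε = 0)
    (hax : IsAxis (vmoment m plus)) (halive : vmoment m plus ≠ 0) (hK : (supp m).card ≤ 2 * B) :
    (supp m).card = 2 * B ∧
    ∀ a : Fin 4, (supp (sl m a)).card = B ∧ (sliceSupp m a).card + (sliceSupp m (a + 1)).card = B ∧
      Disjoint (sliceSupp m a) (sliceSupp m (a + 1)) ∧ supp (sl m a) = sliceSupp m a ∪ sliceSupp m (a + 1) ∧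
      (sliceSupp m a).card = (sliceSupp m (a + 2)).card := by
  have hB : ∀ a : Fin 4, B ≤ (supp (sl m a)).card := fun a =>
    h₁ _ (sl_pure m hpure a) ((isDiag_vmoment_sl_iff hn m hpure a).mpr hax) (sl_alive hn m hpure halive a)
  have hc := fun a => card_supp_sl_le m a
  have hs := sum_card_slices m
  rw [Fin.sum_univ_four] at hs
  have b0 := hB 0; have b1 := hB 1; have b2 := hB 2; have b3 := hB 3
  have c0 := hc 0; have c1 := hc 1; have c2 := hc 2; have c3 := hc 3
  have e01 : ((0 : Fin 4) + 1) = 1 := rfl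
  have e12 : ((1 : Fin 4) + 1) = 2 := rfl
  have e23 : ((2 : Fin 4) + 1) = 3 := rfl
  have e30 : ((3 : Fin 4) + 1) = 0 := rfl
  rw [e01] at c0; rw [e12] at c1; rw [e23] at c2; rw [e30] at c3
  refine ⟨by omega, fun a => ?_⟩
  -- the four slice sizes
  have key : ∀ a : Fin 4, (supp (sl m a)).card = B ∧ (sliceSupp m a).card + (sliceSupp m (a + 1)).card = B ∧
      (sliceSupp m a).card = (sliceSupp m (a + 2)).card := by
    intro a
    fin_cases a
    · refine ⟨?_, ?_, ?_⟩
      · show (supp (sl m 0)).card = B; omega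
      · show (sliceSupp m 0).card + (sliceSupp m 1).card = B; omega
      · show (sliceSupp m 0).card = (sliceSupp m 2).card; omega
    · refine ⟨?_, ?_, ?_⟩
      · show (supp (sl m 1)).card = B; omega
      · show (sliceSupp m 1).card + (sliceSupp m 2).card = B; omega
      · show (sliceSupp m 1).card = (sliceSupp m 3).card; omega
    · refine ⟨?_, ?_, ?_⟩
      · show (supp (sl m 2)).card = B; omega
      · show (sliceSupp m 2).card + (sliceSupp m 3).card = B; omega
      · show (sliceSupp m 2).card = (sliceSupp m 0).card; omega
    · refine ⟨?_, ?_, ?_⟩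
      · show (supp (sl m 3)).card = B; omega
      · show (sliceSupp m 3).card + (sliceSupp m 0).card = B; omega
      · show (sliceSupp m 3).card = (sliceSupp m 1).card; omega
  obtain ⟨k1, k2, k3⟩ := key a
  obtain ⟨hd, he⟩ := disjoint_and_eq_union_of_card (supp (sl m a)) (sliceSupp m a) (sliceSupp m (a + 1))
    (supp_sl_subset m a) (by omega)
  exact ⟨k1, k2, hd, he, k3⟩

/-- **TIGHT OPPOSITE SLICES (W diagonal).** If every pure design on (ℤ∕4)ⁿ with nonzero diagonal Weil moment has at least `B`
letters, and `m` is a pure design on (ℤ∕4)ⁿ⁺¹ with nonzero DIAGONAL Weil moment and at most `2·B` letters, then `#supp m = 2·B`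
exactly and both opposite slice pairs are tight: for a = 0, 1 the opposite pair design `m_a − m_{a+2}` has exactly `B` letters, the
two slices are disjoint with `#A_a + #A_{a+2} = B`, and its support is their union. -/
theorem tight_opposite_of_diag (hn : 0 < n) (B : ℕ)
    (h₁ : ∀ d : Letter n → ℤ, (∀ ε' : Eps n, ε' ≠ plus → ε' ≠ minus → vmoment d ε' = 0) →
      IsDiag (vmoment d plus) → vmoment d plus ≠ 0 → B ≤ (supp d).card)
    (m : Letter (n + 1) → ℤ) (hpure : ∀ ε : Eps (n + 1), ε ≠ plus → ε ≠ minus → vmoment m ε = 0)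
    (hdg : IsDiag (vmoment m plus)) (halive : vmoment m plus ≠ 0) (hK : (supp m).card ≤ 2 * B) :
    (supp m).card = 2 * B ∧
    (∀ a : Fin 4, a = 0 ∨ a = 1 →
      (supp (slOpp m a)).card = B ∧ (sliceSupp m a).card + (sliceSupp m (a + 2)).card = B ∧
      Disjoint (sliceSupp m a) (sliceSupp m (a + 2)) ∧ supp (slOpp m a) = sliceSupp m a ∪ sliceSupp m (a + 2)) := by
  have hB : ∀ a : Fin 4, B ≤ (supp (slOpp m a)).card := fun a =>
    h₁ _ (slOpp_pure m hpure a) ((isDiag_vmoment_slOpp_iff hn m hpure a).mpr hdg) (slOpp_alive hn m hpure halive a)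
  have hs := sum_card_slices m
  rw [Fin.sum_univ_four] at hs
  have b0 := hB 0; have b1 := hB 1
  have c0 := card_supp_slOpp_le m 0; have c1 := card_supp_slOpp_le m 1
  have e02 : ((0 : Fin 4) + 2) = 2 := rfl
  have e13 : ((1 : Fin 4) + 2) = 3 := rfl
  rw [e02] at c0; rw [e13] at c1
  refine ⟨by omega, fun a ha => ?_⟩
  rcases ha with rfl | rfl
  · have k2 : (sliceSupp m 0).card + (sliceSupp m (0 + 2)).card = B := by rw [e02]; omega
    obtain ⟨hd, he⟩ := disjoint_and_eq_union_of_card (supp (slOpp m 0)) (sliceSupp m 0) (sliceSupp m (0 + 2))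
      (supp_slOpp_subset m 0) (by omega)
    exact ⟨by omega, k2, hd, he⟩
  · have k2 : (sliceSupp m 1).card + (sliceSupp m (1 + 2)).card = B := by rw [e13]; omega
    obtain ⟨hd, he⟩ := disjoint_and_eq_union_of_card (supp (slOpp m 1)) (sliceSupp m 1) (sliceSupp m (1 + 2))
      (supp_slOpp_subset m 1) (by omega)
    exact ⟨by omega, k2, hd, he⟩

/-- At the ceiling the adjacent pair designs are EXACT B-supports of the diagonal class: pure, nonzero diagonal Weil moment,
support = the union of two disjoint slices, exactly `B` letters (the form the K = 2B assembly search consumes). -/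
theorem adjacent_pair_exact_of_axis (hn : 0 < n) (B : ℕ)
    (h₁ : ∀ d : Letter n → ℤ, (∀ ε' : Eps n, ε' ≠ plus → ε' ≠ minus → vmoment d ε' = 0) →
      IsDiag (vmoment d plus) → vmoment d plus ≠ 0 → B ≤ (supp d).card)
    (m : Letter (n + 1) → ℤ) (hpure : ∀ ε : Eps (n + 1), ε ≠ plus → ε ≠ minus → vmoment m ε = 0)
    (hax : IsAxis (vmoment m plus)) (halive : vmoment m plus ≠ 0) (hK : (supp m).card ≤ 2 * B) (a : Fin 4) :
    (∀ ε' : Eps n, ε' ≠ plus → ε' ≠ minus → vmoment (sl m a) ε' = 0) ∧ IsDiag (vmoment (sl m a) plus) ∧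
      vmoment (sl m a) plus ≠ 0 ∧ supp (sl m a) = sliceSupp m a ∪ sliceSupp m (a + 1) ∧ (supp (sl m a)).card = B :=
  ⟨sl_pure m hpure a, (isDiag_vmoment_sl_iff hn m hpure a).mpr hax, sl_alive hn m hpure halive a,
    ((tight_adjacent_of_axis hn B h₁ m hpure hax halive hK).2 a).2.2.2.1, ((tight_adjacent_of_axis hn B h₁ m hpure hax halive hK).2 a).1⟩

/-! ## §3 The instance n = 4, B = 36: the structure of a 72-letter design (GIVEN s_diag(4) ≥ 36, machine) -/

/-- **K = 72, AXIS CASE (given s_diag(4) ≥ 36).** A pure design on (ℤ∕4)⁵ with nonzero axis Weil moment and at most 72 letters has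
exactly 72 letters; its four slices along the first letter have sizes k, 36 − k, k, 36 − k; adjacent slices are disjoint; and each of
the four adjacent pair designs is a pure design with nonzero diagonal Weil moment whose support is exactly the union of the two slices,
36 letters — an exact diagonal 36-support on (ℤ∕4)⁴. -/
theorem k72_adjacent_structure
    (sdiag36 : ∀ d : Letter 4 → ℤ, (∀ ε' : Eps 4, ε' ≠ plus → ε' ≠ minus → vmoment d ε' = 0) →
      IsDiag (vmoment d plus) → vmoment d plus ≠ 0 → 36 ≤ (supp d).card)
    (m : Letter 5 → ℤ) (hpure : ∀ ε : Eps 5, ε ≠ plus → ε ≠ minus → vmoment m ε = 0)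
    (hax : IsAxis (vmoment m plus)) (halive : vmoment m plus ≠ 0) (hK : (supp m).card ≤ 72) :
    (supp m).card = 72 ∧
    ∀ a : Fin 4, (supp (sl m a)).card = 36 ∧ (sliceSupp m a).card + (sliceSupp m (a + 1)).card = 36 ∧
      Disjoint (sliceSupp m a) (sliceSupp m (a + 1)) ∧ supp (sl m a) = sliceSupp m a ∪ sliceSupp m (a + 1) ∧
      (sliceSupp m a).card = (sliceSupp m (a + 2)).card :=
  tight_adjacent_of_axis (n := 4) (by norm_num) 36 sdiag36 m hpure hax halive hK

/-- **K = 72, DIAGONAL CASE (given s_diag(4) ≥ 36).** A pure design on (ℤ∕4)⁵ with nonzero diagonal Weil moment and at most 72 letters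
has exactly 72 letters; slices 0, 2 are disjoint with 36 letters together, slices 1, 3 likewise; and the two opposite pair designs
`m_0 − m_2`, `m_1 − m_3` are pure with nonzero diagonal Weil moment and support exactly the union of their two slices (36 letters). -/
theorem k72_opposite_structure
    (sdiag36 : ∀ d : Letter 4 → ℤ, (∀ ε' : Eps 4, ε' ≠ plus → ε' ≠ minus → vmoment d ε' = 0) →
      IsDiag (vmoment d plus) → vmoment d plus ≠ 0 → 36 ≤ (supp d).card)
    (m : Letter 5 → ℤ) (hpure : ∀ ε : Eps 5, ε ≠ plus → ε ≠ minus → vmoment m ε = 0)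
    (hdg : IsDiag (vmoment m plus)) (halive : vmoment m plus ≠ 0) (hK : (supp m).card ≤ 72) :
    (supp m).card = 72 ∧
    (∀ a : Fin 4, a = 0 ∨ a = 1 →
      (supp (slOpp m a)).card = 36 ∧ (sliceSupp m a).card + (sliceSupp m (a + 2)).card = 36 ∧
      Disjoint (sliceSupp m a) (sliceSupp m (a + 2)) ∧ supp (slOpp m a) = sliceSupp m a ∪ sliceSupp m (a + 2)) :=
  tight_opposite_of_diag (n := 4) (by norm_num) 36 sdiag36 m hpure hdg halive hK

/-- **NO 72-DESIGN WITH «OTHER» WEIL MOMENT (given s_other(4) ≥ 37).** If every pure design on (ℤ∕4)⁴ whose Weil moment is neither axis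
nor diagonal has at least 37 letters (of record, machine: s_other(4) ≥ 39, t-8 g15 R6), then a pure design on (ℤ∕4)⁵ with at most
72 letters has an axis or a diagonal Weil moment (W = 0 counts as both) — so §3's two structure theorems cover every 72-design. -/
theorem k72_class_of_sother
    (sother37 : ∀ d : Letter 4 → ℤ, (∀ ε' : Eps 4, ε' ≠ plus → ε' ≠ minus → vmoment d ε' = 0) →
      ¬ IsAxis (vmoment d plus) → ¬ IsDiag (vmoment d plus) → 37 ≤ (supp d).card)
    (m : Letter 5 → ℤ) (hpure : ∀ ε : Eps 5, ε ≠ plus → ε ≠ minus → vmoment m ε = 0)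
    (hK : (supp m).card ≤ 72) :
    IsAxis (vmoment m plus) ∨ IsDiag (vmoment m plus) := by
  by_contra h
  rw [not_or] at h
  obtain ⟨hax, hdg⟩ := h
  have hB : ∀ a : Fin 4, 37 ≤ (supp (sl m a)).card := fun a =>
    sother37 _ (sl_pure m hpure a) (fun h' => hdg ((isAxis_vmoment_sl_iff (by norm_num) m hpure a).mp h'))
      (fun h' => hax ((isDiag_vmoment_sl_iff (by norm_num) m hpure a).mp h'))
  have hsum := sum_card_supp_sl_le m
  rw [Fin.sum_univ_four] at hsum
  have b0 := hB 0; have b1 := hB 1; have b2 := hB 2; have b3 := hB 3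
  omega

end Summit.Ventures.HSemireg.SignedWeilDesignN
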